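import Summits.CriticalPhenomena.PercolationContinuityZ3.Theorems.PercNearOneGluingAdditiveGluingFingerML3Reductions
import HarnessLib

/-! # Crux `PercNearOneGluing.AdditiveGluing` (stmt-CriticalPhenomena-4576) — the finger multi-edge Lemma 3 (`stub_fingerML3_vp`):
# the DESIGNATION SWITCH (seat (b) V⁺-form, depth prover `png-dp-vplus`, gen 9)

Support file (`--supports stmt-CriticalPhenomena-4576`); no definitions, no named facts, no sorries.

`block_multiEdge_of_witness` (…BlockMultiEdge.lean) proves the multi-edge conclusion `μ_g(R ∩ {d↔b}) ≤ μ_g(R ∩ {N↔b})` from a witness `c`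
that is (i) glued-above `d` (`μ_g(d↔b) ≤ μ_g(c↔b)`), (ii) base-below `d` (`τ⁰(c) ≤ τ⁰(d)`, `τ⁰` = reliability with every contact pair killed) and
(iii) base-below EVERY contact relay — (iii) being used only to obtain the conclusion for `c` itself.  This file isolates the exchange step:
(i) + (ii) + [the multi-edge conclusion for `c`] ⟹ [the multi-edge conclusion for `d`] (`block_multiEdge_switch`), because
`μ_g(R ∩ {x↔b}) = μ_g(x↔b) − μ_g([∅]_F)·τ⁰(x)` for every vertex `x` (pattern decomposition over the contact pairs `F`; off `R` the block is
cut off).  In the finger vocabulary (`fingerML3_switch`) this is the move "replace the designated relay `d` by a contact `c`" of the peeling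
reductions (depth-prover memo MEMO-gen9 §4, move M2): the conclusion for `c` is then supplied by `fingerML3_of_dPairsKilled` / `fingerML3_peel`
applied to the system with the pairs `N–c` killed, where `c` is untouched.
[cite: KozmaNitzan2024, Lemma 3(i) (pp. 6–7), Lemma 5 (p. 13), §3.2 pp. 12–14]
-/

namespace Summit.CriticalPhenomena.PercolationContinuityZ3.Theorems

open MeasureTheory Set
open Literature.Probability.LatticeModels (prodBernoulli)
open Literature.Probability.Percolation (BondConfig openConn openGraph pinW localCylinder DeterminedBy)

noncomputable section
open Classical

section FingerSwitch

open Literature.Probability.LatticeModels Literature.Probability.Percolation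

variable {n : ℕ}

/-- **Designation switch, block form.**  `g` any weighting, `F` any finite set of pairs, `R` = some pair of `F` open, `U` any event,
`τ⁰` = reliability under `pinW g F ∅` (all of `F` killed).  If `μ_g(d↔b) ≤ μ_g(c↔b)`, `τ⁰(c) ≤ τ⁰(d)` and `μ_g(R ∩ {c↔b}) ≤ μ_g(R ∩ U)`,
then `μ_g(R ∩ {d↔b}) ≤ μ_g(R ∩ U)`: indeed `μ_g({x↔b} ∩ Rᶜ) = μ_g([∅]_F)·τ⁰(x)`, so `μ_g(R ∩ {d↔b}) = μ_g(d↔b) − μ_g([∅]_F)τ⁰(d) ≤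
μ_g(c↔b) − μ_g([∅]_F)τ⁰(c) = μ_g(R ∩ {c↔b})`.  (Steps (iii) of `block_multiEdge_of_witness`.) [cite: KozmaNitzan2024, §3.2 pp. 12–14] -/
theorem block_multiEdge_switch (g : Sym2 (Fin n) → unitInterval) (F : Finset (Sym2 (Fin n))) (U : Set (BondConfig (Fin n)))
    (d c b : Fin n)
    (hcd : (prodBernoulli (pinW g (↑F : Set (Sym2 (Fin n))) ↑(∅ : Finset (Sym2 (Fin n))))).real (openConn c b) ≤
      (prodBernoulli (pinW g (↑F : Set (Sym2 (Fin n))) ↑(∅ : Finset (Sym2 (Fin n))))).real (openConn d b))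
    (hdc : (prodBernoulli g).real (openConn d b) ≤ (prodBernoulli g).real (openConn c b))
    (hc : (prodBernoulli g).real ({ω : Set (Sym2 (Fin n)) | ∃ e ∈ F, e ∈ ω} ∩ openConn c b) ≤
      (prodBernoulli g).real ({ω : Set (Sym2 (Fin n)) | ∃ e ∈ F, e ∈ ω} ∩ U)) :
    (prodBernoulli g).real ({ω : Set (Sym2 (Fin n)) | ∃ e ∈ F, e ∈ ω} ∩ openConn d b) ≤
      (prodBernoulli g).real ({ω : Set (Sym2 (Fin n)) | ∃ e ∈ F, e ∈ ω} ∩ U) := by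
  set R : Set (Set (Sym2 (Fin n))) := {ω | ∃ e ∈ F, e ∈ ω} with hRdef
  set w₀ : Sym2 (Fin n) → unitInterval := pinW g ↑F ↑(∅ : Finset (Sym2 (Fin n))) with hw₀
  set τ₀ : Fin n → ℝ := fun v => (prodBernoulli w₀).real (openConn v b) with hτ₀
  have hcd' : τ₀ c ≤ τ₀ d := hcd
  have hRm : MeasurableSet R := MeasurableSet.of_discrete
  have hdetC : DeterminedBy Rᶜ (↑F : Set (Sym2 (Fin n))) := determinedBy_forall_not_mem F
  have hdecC := fun v : Fin n =>
    prodBernoulli_real_inter_eq_sum_pinW g F (A := openConn v b) (B := Rᶜ) MeasurableSet.of_discrete hdetC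
  -- off `R` only the empty pattern survives
  have hN : ∀ v : Fin n, (prodBernoulli g).real (openConn v b ∩ Rᶜ) =
      (prodBernoulli g).real (localCylinder ↑F ↑(∅ : Finset (Sym2 (Fin n)))) * τ₀ v := by
    intro v
    rw [hdecC v]
    refine Finset.sum_eq_single_of_mem ∅ ?_ ?_
    · refine (@Finset.mem_filter _ _ (_) _ _).2 ⟨Finset.mem_powerset.2 (Finset.empty_subset F), ?_⟩
      rintro ⟨e, -, he⟩
      exact Finset.notMem_empty e (Finset.mem_coe.1 he)
    · intro J hJ hne
      exfalso
      obtain ⟨hJF, hno⟩ := (@Finset.mem_filter _ _ (_) _ _).1 hJ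
      obtain ⟨e, heJ⟩ := Finset.nonempty_iff_ne_empty.2 hne
      exact hno ⟨e, Finset.mem_powerset.1 hJF heJ, Finset.mem_coe.2 heJ⟩
  have hsplit : ∀ v : Fin n, (prodBernoulli g).real (openConn v b ∩ R) +
      (prodBernoulli g).real (openConn v b ∩ Rᶜ) = (prodBernoulli g).real (openConn v b) :=
    fun v => measureReal_inter_add_sdiff (μ := prodBernoulli g) (s := openConn v b) hRm
  -- `μ(d↔b, R) ≤ μ(c↔b, R)` from `τ(d) ≤ τ(c)` and `τ⁰(c) ≤ τ⁰(d)`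
  have hdc' : (prodBernoulli g).real (openConn d b ∩ R) ≤ (prodBernoulli g).real (openConn c b ∩ R) := by
    have hd := hsplit d
    have hc' := hsplit c
    rw [hN] at hd hc'
    have hmono : (prodBernoulli g).real (localCylinder ↑F ↑(∅ : Finset (Sym2 (Fin n)))) * τ₀ c ≤
        (prodBernoulli g).real (localCylinder ↑F ↑(∅ : Finset (Sym2 (Fin n)))) * τ₀ d :=
      mul_le_mul_of_nonneg_left hcd' measureReal_nonneg
    linarith
  have hc' : (prodBernoulli g).real (openConn c b ∩ R) ≤ (prodBernoulli g).real (R ∩ U) := by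
    rw [Set.inter_comm (openConn c b) R]; exact hc
  rw [Set.inter_comm R (openConn d b)]
  exact hdc'.trans hc'

/-- **Designation switch, finger vocabulary (move M2 of the peeling reductions).**  Stub setting (`K`, relays `A`, block `N` with
`Disjoint N A`, every positive-weight pair at `N` going to `A` or staying inside `N`), `q` = `K` with every pair at `N` killed, `g = K/N`.
If a vertex `c ∉ N` satisfies `μ_g(d↔b) ≤ μ_g(c↔b)` (glued) and `μ_q(c↔b) ≤ μ_q(d↔b)` (block deleted), then FML3(`c`) implies FML3(`d`):
`μ_g(R ∩ {c↔b}) ≤ μ_g(R ∩ ⋃_{v∈N}{v↔b}) ⟹ μ_g(R ∩ {d↔b}) ≤ μ_g(R ∩ ⋃_{v∈N}{v↔b})`.  For a contact `c ∈ A`, FML3(`c`) is FML3 of the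
system with the pairs `N–c` killed (`fingerML3_of_dPairsKilled`), where `c` is untouched. [cite: KozmaNitzan2024, §3.2 pp. 12–14] -/
theorem fingerML3_switch (K : Sym2 (Fin n) → unitInterval) (A N : Finset (Fin n)) (d c b : Fin n)
    (hNA : Disjoint N A) (hc : c ∉ N) (hd : d ∉ N)
    (hfree : ∀ v ∈ N, ∀ y : Fin n, y ∉ A → y ∉ N → (K s(v, y) : ℝ) = 0)
    (hcd : (prodBernoulli (fun e' : Sym2 (Fin n) => if (∃ y ∈ e', y ∈ N) then (0 : unitInterval) else K e')).real (openConn c b) ≤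
      (prodBernoulli (fun e' : Sym2 (Fin n) => if (∃ y ∈ e', y ∈ N) then (0 : unitInterval) else K e')).real (openConn d b))
    (hle : (prodBernoulli (fun e' : Sym2 (Fin n) => if (∀ y ∈ e', y ∈ N) ∧ ¬ e'.IsDiag then 1 else K e')).real (openConn d b) ≤
      (prodBernoulli (fun e' : Sym2 (Fin n) => if (∀ y ∈ e', y ∈ N) ∧ ¬ e'.IsDiag then 1 else K e')).real (openConn c b))
    (hFc : (prodBernoulli (fun e' : Sym2 (Fin n) => if (∀ y ∈ e', y ∈ N) ∧ ¬ e'.IsDiag then 1 else K e')).real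
        ({ω : Set (Sym2 (Fin n)) | ∃ v ∈ N, ∃ a ∈ A, s(v, a) ∈ ω} ∩ openConn c b) ≤
      (prodBernoulli (fun e' : Sym2 (Fin n) => if (∀ y ∈ e', y ∈ N) ∧ ¬ e'.IsDiag then 1 else K e')).real
        ({ω : Set (Sym2 (Fin n)) | ∃ v ∈ N, ∃ a ∈ A, s(v, a) ∈ ω} ∩ ⋃ v ∈ N, openConn v b)) :
    (prodBernoulli (fun e' : Sym2 (Fin n) => if (∀ y ∈ e', y ∈ N) ∧ ¬ e'.IsDiag then 1 else K e')).real
        ({ω : Set (Sym2 (Fin n)) | ∃ v ∈ N, ∃ a ∈ A, s(v, a) ∈ ω} ∩ openConn d b) ≤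
      (prodBernoulli (fun e' : Sym2 (Fin n) => if (∀ y ∈ e', y ∈ N) ∧ ¬ e'.IsDiag then 1 else K e')).real
        ({ω : Set (Sym2 (Fin n)) | ∃ v ∈ N, ∃ a ∈ A, s(v, a) ∈ ω} ∩ ⋃ v ∈ N, openConn v b) := by
  set g : Sym2 (Fin n) → unitInterval := fun e' => if (∀ y ∈ e', y ∈ N) ∧ ¬ e'.IsDiag then 1 else K e' with hg
  set q : Sym2 (Fin n) → unitInterval := fun e' => if (∃ y ∈ e', y ∈ N) then (0 : unitInterval) else K e' with hq
  set F : Finset (Sym2 (Fin n)) := (N ×ˢ A).image (fun va : Fin n × Fin n => s(va.1, va.2)) with hFdef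
  rw [fingerContact_R_eq N A] at hFc
  rw [fingerContact_R_eq N A]
  -- shape of the contact pairs and the glued clique
  have hF : ∀ e ∈ F, ∃ v ∈ N, ∃ a ∉ N, e = s(v, a) := by
    intro e he
    obtain ⟨⟨v, a⟩, hva, rfl⟩ := Finset.mem_image.1 he
    obtain ⟨hv, ha⟩ := Finset.mem_product.1 hva
    exact ⟨v, hv, a, Finset.disjoint_left.1 hNA.symm ha, rfl⟩
  -- the base weighting `pinW g F ∅` and `q` agree off the block and both cut the block off
  set w₀ : Sym2 (Fin n) → unitInterval := pinW g (↑F : Set (Sym2 (Fin n))) ↑(∅ : Finset (Sym2 (Fin n))) with hw₀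
  have hin : ∀ e : Sym2 (Fin n), (∀ z ∈ e, z ∉ N) → w₀ e = q e := by
    intro e he
    have heF : e ∉ (↑F : Set (Sym2 (Fin n))) := by
      intro heF
      obtain ⟨v, hv, a, -, rfl⟩ := hF e (Finset.mem_coe.1 heF)
      exact he v (Sym2.mem_mk_left v a) hv
    rw [hw₀, pinW_apply_of_not_mem g _ heF]
    have h1 : ¬ ((∀ y ∈ e, y ∈ N) ∧ ¬ e.IsDiag) := by
      induction e using Sym2.ind with
      | h u u' => exact fun h => he u (Sym2.mem_mk_left u u') (h.1 u (Sym2.mem_mk_left u u'))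
    have h2 : ¬ (∃ y ∈ e, y ∈ N) := fun ⟨y, hy, hyN⟩ => he y hy hyN
    simp only [hg, hq, h1, h2, if_false]
  have hw₀cut : ∀ u : Fin n, u ∉ N → ∀ v ∈ N, w₀ s(u, v) = 0 := by
    intro u hu v hv
    by_cases huA : u ∈ A
    · have he : s(u, v) ∈ (↑F : Set (Sym2 (Fin n))) := by
        refine Finset.mem_coe.2 (Finset.mem_image.2 ⟨(v, u), Finset.mem_product.2 ⟨hv, huA⟩, ?_⟩)
        exact Sym2.eq_swap
      rw [hw₀, pinW_apply_of_mem_of_not_mem g he (by simp)]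
    · have he : s(u, v) ∉ (↑F : Set (Sym2 (Fin n))) := by
        intro heF
        obtain ⟨⟨v', a'⟩, hva, he'⟩ := Finset.mem_image.1 (Finset.mem_coe.1 heF)
        obtain ⟨hv', ha'⟩ := Finset.mem_product.1 hva
        dsimp only at he'
        rcases Sym2.eq_iff.1 he' with ⟨h1, h2⟩ | ⟨h1, h2⟩
        · exact hu (h1 ▸ hv')
        · exact huA (h2 ▸ ha')
      rw [hw₀, pinW_apply_of_not_mem g _ he]
      have h1 : ¬ ((∀ y ∈ s(u, v), y ∈ N) ∧ ¬ (s(u, v)).IsDiag) := fun h => hu (h.1 u (Sym2.mem_mk_left u v))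
      simp only [hg, h1, if_false]
      have := hfree v hv u huA hu
      rw [Sym2.eq_swap]
      exact Subtype.ext (by exact_mod_cast this)
  have hqcut : ∀ u : Fin n, u ∉ N → ∀ v ∈ N, q s(u, v) = 0 := by
    intro u hu v hv
    have : ∃ y ∈ s(u, v), y ∈ N := ⟨v, Sym2.mem_mk_right u v, hv⟩
    simp only [hq, this, if_true]
  have hloc : ∀ y : Fin n, y ∉ N → (prodBernoulli w₀).real (openConn y b) = (prodBernoulli q).real (openConn y b) :=
    fun y hy => openConn_real_eq_offBlock w₀ q N b hy hin hw₀cut hqcut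
  refine block_multiEdge_switch g F (⋃ v ∈ N, openConn v b) d c b ?_ hle hFc
  rw [hloc c hc, hloc d hd]
  exact hcd

end FingerSwitch

end

end Summit.CriticalPhenomena.PercolationContinuityZ3.Theorems
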